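import Summits.NavierStokesRegularity.NavierStokesRegularity.Theorems.ExtremiserTransiencePinnedDepletionSandwich
import HarnessLib

/-!
# Crux `NearExtremalTransiencePerFlow` (stmt-NavierStokesRegularity-26567), LINE g13-β `relay` (ns-idea-5 g13):
# R♭ — THE RELAY OBSTRUCTION (PROVED), and the relay cut D♭ ⇒ junction ⇒ crux BY NAME

Theorems file (`--supports stmt-NavierStokesRegularity-26567`, helper; prover seat ns-net-p1 g17) landing §1b/§3/§5 of the
files-only skeleton `Cruxes/NearExtremalTransiencePerFlow/Lines/relay.lean` REV 2 (ns-idea-5 g13, crux-write 09c2e443f072; critic of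
record idea-crit-4 g10: PASS B, restamp 15:34:28Z) with the statements unfolded VERBATIM (R♭ `RelayObstruction` :126, D♭
`CellRelayDecomposition` :149, rev-2 ONE-SIDED persistence against the window start).

Lever «has-beens keep their weight» (mined from crowd examples): for far-apart cells the depletion quotient is sub-convex,
`q(Σvᵢ) ≤ Σλᵢqᵢ`, `Σλᵢ ≤ 1`; integrated in time with weight persistence `Λ` and individual efficient fraction `η`, a crowd is
`ε`-depleted on `≥ (1 − 2Λη)` of the window for every `ε ≤ δ₀/2`, WHATEVER THE NUMBER OF CELLS.

* `relayObstruction_holds` — **R♭** (abstract real analysis on a window `[a, a+L]`): weights `wᵢ ≥ 0` measurable with `Σᵢ wᵢ ≤ 1`,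
  quotients `qᵢ ≤ κ` measurable, one-sided persistence `wᵢ(t') ≤ Λ wᵢ(a)`, individual transience `|{qᵢ > κ − δ₀} ∩ I| ≤ ηL` ⇒
  `|{Σᵢ wᵢqᵢ ≤ κ − ε} ∩ I| ≥ εL` for `0 < ε ≤ min(δ₀/2, 1 − 2Λη)`.  Proof (planner's, Mathlib measure theory, verbatim): on the bad set the
  currently-efficient cells carry weight `≥ 1/2`; integrate `Gᵢ = 𝟙_{Eᵢ}·2wᵢ`, swap `∑'`/`∫⁻` (`lintegral_tsum`), bound each cell by
  persistence and its transience, sum `Σ wᵢ(a) ≤ 1`: `|bad| ≤ 2ΛηL`; complement inside the window.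
* `pinnedDepletedFraction_of_cellRelayDecomposition` — **the relay cut** D♭ ⇒ `PinnedDepletedFraction` (`ε = min(δ₀/2, (1−2Λη)/2)`; R♭ on
  the pinned window; `{Σwq ≤ κ⋆ − ε} ∩ I ⊆ DEPLETED_ε ∩ I` by domination).
* `nearExtremalTransiencePerFlow_of_cellRelayDecomposition` — **the heart D♭ closes the crux BY NAME** (= the skeleton's
  `NearExtremalTransiencePerFlow_of_heart`), through the pinned sandwich `PinnedDepletion.nearExtremalTransiencePerFlow_of_pinnedDepletedFraction`.

HONEST FRAMING: R♭ is elementary; D♭ is a conjecture about the cell structure of near-extremal pinned windows inside a hypothetical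
Type-I violator (OPEN), as are the junction `PinnedDepletedFraction`, ⟨26567⟩ and NS regularity; nothing about Navier–Stokes regularity
or blow-up is proved; no summit is proved by a line. [folklore]
-/

noncomputable section

open scoped Topology InnerProductSpace RealInnerProductSpace ENNReal ContDiff
open MeasureTheory Filter Set Metric
open Literature.Analysis.FluidPDE
open Summit.NavierStokesRegularity.NavierStokesRegularity.Theses.ExtremiserTransience
open Summit.NavierStokesRegularity.NavierStokesRegularity.Theorems
open Summit.NavierStokesRegularity.NavierStokesRegularity.Theorems.DepletionLadder.KStar.HalfSpace
open Summit.NavierStokesRegularity.NavierStokesRegularity.Theorems.NearExtremalTransiencePerFlow.ZoneTransversality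
open Summit.NavierStokesRegularity.NavierStokesRegularity.Theorems.NearExtremalTransiencePerFlow.DepletedFraction

namespace Summit.NavierStokesRegularity.NavierStokesRegularity.Theorems.NearExtremalTransiencePerFlow.PinnedDepletion

-- the summit's namespace repeats the problem name by convention (D-0017)
set_option linter.dupNamespace false

/-! ### §1 R♭ — the relay obstruction (abstract; Tonelli for `tsum`, persistence against the left endpoint, complement in the window) -/

/-- **R♭ `RelayObstruction` holds** (LINE g13-β `relay` REV 2 :126 on crux stmt-NavierStokesRegularity-26567, statement VERBATIM).
On a window `[a, a+L]`: weights `wᵢ ≥ 0` (measurable, `Σᵢ wᵢ ≤ 1`), quotients `qᵢ ≤ κ` (measurable), ONE-SIDED persistence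
`wᵢ(t') ≤ Λ·wᵢ(a)`, individual transience `|{qᵢ > κ − δ₀} ∩ I| ≤ ηL` for every `i` ⇒ the combination `Σᵢ wᵢqᵢ` is `≤ κ − ε` on a
set of measure `≥ εL`, for every `0 < ε ≤ min(δ₀/2, 1 − 2Λη)` («has-beens keep their weight»: no relay of near-extremality among
individually transient cells).  Proof: the planner's in-file proof (ns-idea-5 g13) verbatim. [folklore] -/
theorem relayObstruction_holds :
    ∀ (κ δ₀ η Λ ε a L : ℝ), 0 < δ₀ → δ₀ ≤ κ → 0 ≤ η → 1 ≤ Λ → 0 < ε → ε ≤ δ₀ / 2 → ε ≤ 1 - 2 * Λ * η → 0 < L →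
    ∀ (w q : ℕ → ℝ → ℝ),
      (∀ i, Measurable (w i)) → (∀ i, Measurable (q i)) →
      (∀ i t', 0 ≤ w i t') →
      (∀ t' ∈ Set.Icc a (a + L), Summable (fun i => w i t') ∧ ∑' i, w i t' ≤ 1) →
      (∀ i, ∀ t' ∈ Set.Icc a (a + L), q i t' ≤ κ) →
      (∀ i, ∀ t' ∈ Set.Icc a (a + L), w i t' ≤ Λ * w i a) →
      (∀ i, volume ({t' : ℝ | κ - δ₀ < q i t'} ∩ Set.Icc a (a + L)) ≤ ENNReal.ofReal (η * L)) →
      ENNReal.ofReal (ε * L) ≤ volume ({t' : ℝ | ∑' i, w i t' * q i t' ≤ κ - ε} ∩ Set.Icc a (a + L)) := by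
  intro κ δ₀ η Λ ε a L hδ₀ hδκ hη hΛ hε hε1 hε2 hL w q hwm hqm hw0 hsum hqle hpers htrans
  set I : Set ℝ := Icc a (a + L) with hI
  have haI : a ∈ I := ⟨le_rfl, by linarith⟩
  have hIm : MeasurableSet I := measurableSet_Icc
  have hΛ0 : 0 ≤ Λ := by linarith
  -- efficient sets of the cells
  set E : ℕ → Set ℝ := fun i => {t' | κ - δ₀ < q i t'} with hE
  have hEm : ∀ i, MeasurableSet (E i) := fun i => measurableSet_lt measurable_const (hqm i)
  -- G i := 𝟙_{E i} · ofReal (2 w i)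
  set G : ℕ → ℝ → ℝ≥0∞ := fun i => (E i).indicator (fun t' => ENNReal.ofReal (2 * w i t')) with hG
  have hGm : ∀ i, Measurable (G i) := fun i =>
    (ENNReal.measurable_ofReal.comp ((hwm i).const_mul 2)).indicator (hEm i)
  have hGsm : Measurable (fun t' => ∑' i, G i t') := Measurable.tsum hGm
  -- the measurable bad set B' ⊇ the bad set
  set B' : Set ℝ := {t' | 1 ≤ ∑' i, G i t'} ∩ I with hB'
  have hB'm : MeasurableSet B' := (hGsm measurableSet_Ici).inter hIm
  have hB'sub : B' ⊆ I := inter_subset_right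
  -- Step A: a bad time (crowd efficient) has currently-efficient weight ≥ 1/2, i.e. Σ' G ≥ 1
  have hptw : ∀ t' ∈ I, κ - ε < ∑' i, w i t' * q i t' → 1 ≤ ∑' i, G i t' := by
    intro t' ht'I hbad
    have hws : Summable (fun i => w i t') := (hsum t' ht'I).1
    have hw1 : ∑' i, w i t' ≤ 1 := (hsum t' ht'I).2
    have hpos : 0 < ∑' i, w i t' * q i t' := by
      have : 0 < κ - ε := by linarith
      linarith
    have hwqs : Summable (fun i => w i t' * q i t') := by
      by_contra h
      rw [tsum_eq_zero_of_not_summable h] at hpos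
      exact lt_irrefl _ hpos
    set g : ℕ → ℝ := fun i => (E i).indicator (fun s => w i s) t' with hg
    have hg_mem : ∀ i, t' ∈ E i → g i = w i t' := fun i hi => by simp [hg, Set.indicator_of_mem hi]
    have hg_nmem : ∀ i, t' ∉ E i → g i = 0 := fun i hi => by simp [hg, Set.indicator_of_notMem hi]
    have hg0 : ∀ i, 0 ≤ g i := by
      intro i; by_cases hi : t' ∈ E i
      · rw [hg_mem i hi]; exact hw0 i t'
      · rw [hg_nmem i hi]
    have hgle : ∀ i, g i ≤ w i t' := by
      intro i; by_cases hi : t' ∈ E i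
      · rw [hg_mem i hi]
      · rw [hg_nmem i hi]; exact hw0 i t'
    have hgs : Summable g := Summable.of_nonneg_of_le hg0 hgle hws
    have hpt : ∀ i, w i t' * q i t' ≤ (κ - δ₀) * w i t' + δ₀ * g i := by
      intro i
      by_cases hi : t' ∈ E i
      · rw [hg_mem i hi]
        have := hqle i t' ht'I
        nlinarith [hw0 i t']
      · rw [hg_nmem i hi]
        have hqi : q i t' ≤ κ - δ₀ := not_lt.mp hi
        nlinarith [hw0 i t']
    have htsum_le : ∑' i, w i t' * q i t' ≤ (κ - δ₀) * ∑' i, w i t' + δ₀ * ∑' i, g i := by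
      have h1 : ∑' i, w i t' * q i t' ≤ ∑' i, ((κ - δ₀) * w i t' + δ₀ * g i) :=
        hwqs.tsum_le_tsum hpt ((hws.mul_left _).add (hgs.mul_left _))
      have h2 : ∑' i, ((κ - δ₀) * w i t' + δ₀ * g i) = (κ - δ₀) * ∑' i, w i t' + δ₀ * ∑' i, g i := by
        rw [(hws.mul_left _).tsum_add (hgs.mul_left _), tsum_mul_left, tsum_mul_left]
      linarith
    have hκδ : 0 ≤ κ - δ₀ := by linarith
    have hS : (κ - δ₀) * ∑' i, w i t' ≤ κ - δ₀ := by nlinarith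
    have hhalf : (1:ℝ) / 2 ≤ ∑' i, g i := by
      by_contra hc
      have hc' : ∑' i, g i < 1 / 2 := not_le.mp hc
      have : δ₀ * ∑' i, g i ≤ δ₀ * (1 / 2) := mul_le_mul_of_nonneg_left hc'.le hδ₀.le
      linarith
    have h2g : (1:ℝ) ≤ ∑' i, 2 * g i := by rw [tsum_mul_left]; linarith
    have hGeq : ∀ i, G i t' = ENNReal.ofReal (2 * g i) := by
      intro i
      by_cases hi : t' ∈ E i
      · simp [hG, Set.indicator_of_mem hi, hg_mem i hi]
      · simp [hG, Set.indicator_of_notMem hi, hg_nmem i hi]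
    have h2g0 : ∀ i, 0 ≤ 2 * g i := fun i => by linarith [hg0 i]
    calc (1 : ℝ≥0∞) = ENNReal.ofReal 1 := ENNReal.ofReal_one.symm
      _ ≤ ENNReal.ofReal (∑' i, 2 * g i) := ENNReal.ofReal_le_ofReal h2g
      _ = ∑' i, ENNReal.ofReal (2 * g i) := ENNReal.ofReal_tsum_of_nonneg h2g0 (hgs.mul_left 2)
      _ = ∑' i, G i t' := tsum_congr fun i => (hGeq i).symm
  -- Step B: per-cell integral bound by persistence and individual transience
  have hcell : ∀ i, ∫⁻ t' in I, G i t' ≤ ENNReal.ofReal (2 * Λ * w i a) * ENNReal.ofReal (η * L) := by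
    intro i
    have hle : ∀ t' ∈ I, G i t' ≤ (E i).indicator (fun _ => ENNReal.ofReal (2 * Λ * w i a)) t' := by
      intro t' ht'
      by_cases hi : t' ∈ E i
      · simp only [hG, Set.indicator_of_mem hi]
        refine ENNReal.ofReal_le_ofReal ?_
        have := hpers i t' ht'
        nlinarith
      · simp [hG, Set.indicator_of_notMem hi]
    calc ∫⁻ t' in I, G i t' ≤ ∫⁻ t' in I, (E i).indicator (fun _ => ENNReal.ofReal (2 * Λ * w i a)) t' :=
          setLIntegral_mono' hIm hle
      _ = ENNReal.ofReal (2 * Λ * w i a) * volume (E i ∩ I) := by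
          rw [lintegral_indicator_const (hEm i), Measure.restrict_apply (hEm i)]
      _ ≤ ENNReal.ofReal (2 * Λ * w i a) * ENNReal.ofReal (η * L) := by
          gcongr
          exact htrans i
  -- Step C: the measurable bad set is small: volume B' ≤ ofReal (2Λη L)
  have hwsa : Summable (fun i => w i a) := (hsum a haI).1
  have hw1a : ∑' i, w i a ≤ 1 := (hsum a haI).2
  have hB'small : volume B' ≤ ENNReal.ofReal (2 * Λ * η * L) := by
    have h1 : volume B' = ∫⁻ t' in B', (1 : ℝ≥0∞) := (setLIntegral_one B').symm
    have h2 : ∫⁻ t' in B', (1 : ℝ≥0∞) ≤ ∫⁻ t' in B', ∑' i, G i t' :=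
      setLIntegral_mono' hB'm fun t' ht' => ht'.1
    have h3 : ∫⁻ t' in B', ∑' i, G i t' ≤ ∫⁻ t' in I, ∑' i, G i t' := lintegral_mono_set hB'sub
    have h4 : ∫⁻ t' in I, ∑' i, G i t' = ∑' i, ∫⁻ t' in I, G i t' :=
      lintegral_tsum fun i => (hGm i).aemeasurable
    have h5 : ∑' i, ∫⁻ t' in I, G i t' ≤ ∑' i, ENNReal.ofReal (2 * Λ * w i a) * ENNReal.ofReal (η * L) :=
      ENNReal.tsum_le_tsum hcell
    have h6 : ∑' i, ENNReal.ofReal (2 * Λ * w i a) * ENNReal.ofReal (η * L)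
        = ENNReal.ofReal (2 * Λ) * (∑' i, ENNReal.ofReal (w i a)) * ENNReal.ofReal (η * L) := by
      rw [ENNReal.tsum_mul_right, ← ENNReal.tsum_mul_left]
      congr 1
      refine tsum_congr fun i => ?_
      rw [← ENNReal.ofReal_mul (by positivity), mul_assoc]
    have h7 : ∑' i, ENNReal.ofReal (w i a) = ENNReal.ofReal (∑' i, w i a) :=
      (ENNReal.ofReal_tsum_of_nonneg (fun i => hw0 i a) hwsa).symm
    have h8 : ENNReal.ofReal (∑' i, w i a) ≤ 1 := by
      rw [← ENNReal.ofReal_one]; exact ENNReal.ofReal_le_ofReal hw1a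
    calc volume B' = ∫⁻ t' in B', (1 : ℝ≥0∞) := h1
      _ ≤ ∑' i, ENNReal.ofReal (2 * Λ * w i a) * ENNReal.ofReal (η * L) := (h2.trans h3).trans (h4.le.trans h5)
      _ = ENNReal.ofReal (2 * Λ) * (∑' i, ENNReal.ofReal (w i a)) * ENNReal.ofReal (η * L) := h6
      _ ≤ ENNReal.ofReal (2 * Λ) * 1 * ENNReal.ofReal (η * L) := by rw [h7]; gcongr
      _ = ENNReal.ofReal (2 * Λ * η * L) := by
          rw [mul_one, ← ENNReal.ofReal_mul (by positivity)]; ring_nf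
  -- Step D: complement inside the window
  have hgood : I \ B' ⊆ {t' : ℝ | ∑' i, w i t' * q i t' ≤ κ - ε} ∩ I := by
    intro t' ht'
    refine ⟨?_, ht'.1⟩
    by_contra hc
    exact ht'.2 ⟨hptw t' ht'.1 (not_le.mp hc), ht'.1⟩
  have hvolI : volume I = ENNReal.ofReal L := by
    rw [hI, Real.volume_Icc]; ring_nf
  have hB'fin : volume B' ≠ (⊤ : ℝ≥0∞) := ((measure_mono hB'sub).trans_lt (by rw [hvolI]; exact ENNReal.ofReal_lt_top)).ne
  have hdiff : volume (I \ B') = volume I - volume B' := measure_sdiff hB'sub hB'm.nullMeasurableSet hB'fin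
  have h2ΛηL : 0 ≤ 2 * Λ * η * L := by positivity
  calc ENNReal.ofReal (ε * L) ≤ ENNReal.ofReal (L - 2 * Λ * η * L) := by
        refine ENNReal.ofReal_le_ofReal ?_; nlinarith
    _ = ENNReal.ofReal L - ENNReal.ofReal (2 * Λ * η * L) := ENNReal.ofReal_sub _ h2ΛηL
    _ ≤ volume I - volume B' := by rw [hvolI]; exact tsub_le_tsub_left hB'small _
    _ = volume (I \ B') := hdiff.symm
    _ ≤ _ := measure_mono hgood

/-! ### §2 The relay cut: D♭ ⇒ the junction `PinnedDepletedFraction` (domination + R♭; no analysis) -/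

/-- **The relay cut** (`relay.lean` §3 `pinnedDepletedFraction_of_relay`, with R♭ discharged by `relayObstruction_holds`; statements
VERBATIM): the heart D♭ `CellRelayDecomposition` (per violator, pinned; measurable weight/quotient families on every pinned admissible
window with `wᵢ ≥ 0`, `Σwᵢ ≤ 1`, `qᵢ ≤ κ⋆`, one-sided persistence `wᵢ(t') ≤ Λwᵢ(t)`, individual transience, DOMINATION
`|J(t')| ≤ (Σᵢwᵢqᵢ)·M'√Z√P`) implies `PinnedDepletedFraction`: `ε = min(δ₀/2, (1 − 2Λη)/2)`; R♭ on `[t, t + τ₁ν/M²]`;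
`{Σwq ≤ κ⋆ − ε} ∩ I ⊆ DEPLETED_ε ∩ I` since the factor `M'√Z√P` is non-negative. [folklore] -/
theorem pinnedDepletedFraction_of_cellRelayDecomposition
    (hD : ∀ (C ν T : ℝ) (u : ℝ → EuclideanSpace ℝ (Fin 3) → EuclideanSpace ℝ (Fin 3)) (p : ℝ → EuclideanSpace ℝ (Fin 3) → ℝ),
      IsViolator C ν T u p →
      ∀ (Θ G H τ₁ : ℝ), 0 < Θ → 0 < G → 0 < H → 0 < τ₁ →
      ∃ δ₀ η Λ : ℝ, 0 < δ₀ ∧ δ₀ ≤ kStar ∧ 0 ≤ η ∧ 1 ≤ Λ ∧ 2 * Λ * η < 1 ∧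
      ∀ (t M : ℝ), 0 ≤ t → 0 < M → t + τ₁ * ν / M ^ 2 < T → M = C * Real.sqrt ν / Real.sqrt (T - t) →
        (∀ x, ‖u t x‖ ≤ M) →
        (∫ x, ‖curl (u t) x‖ ^ 2) ≤ Θ * (ν / M) ^ 2 * (∫ x, frobeniusNormSq (fderiv ℝ (curl (u t)) x)) →
        (∀ x, ‖fderiv ℝ (u t) x‖ ≤ G * M ^ 2 / ν) →
        (∀ t' ∈ Set.Icc t (t + τ₁ * ν / M ^ 2), ∀ x, ‖u t' x‖ ≤ H * M) →
        ∃ (w q : ℕ → ℝ → ℝ),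
          (∀ i, Measurable (w i)) ∧ (∀ i, Measurable (q i)) ∧
          (∀ i t', 0 ≤ w i t') ∧
          (∀ t' ∈ Set.Icc t (t + τ₁ * ν / M ^ 2), Summable (fun i => w i t') ∧ ∑' i, w i t' ≤ 1) ∧
          (∀ i, ∀ t' ∈ Set.Icc t (t + τ₁ * ν / M ^ 2), q i t' ≤ kStar) ∧
          (∀ i, ∀ t' ∈ Set.Icc t (t + τ₁ * ν / M ^ 2), w i t' ≤ Λ * w i t) ∧
          (∀ i, volume ({t' : ℝ | kStar - δ₀ < q i t'} ∩ Set.Icc t (t + τ₁ * ν / M ^ 2)) ≤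
            ENNReal.ofReal (η * (τ₁ * ν / M ^ 2))) ∧
          (∀ t' ∈ Set.Icc t (t + τ₁ * ν / M ^ 2), ∀ M' : ℝ, (∀ x, ‖u t' x‖ ≤ M') →
            |∫ x, ⟪curl (u t') x, fderiv ℝ (u t') x (curl (u t') x)⟫_ℝ| ≤
              (∑' i, w i t' * q i t') * M' * Real.sqrt (∫ x, ‖curl (u t') x‖ ^ 2) *
                Real.sqrt (∫ x, frobeniusNormSq (fderiv ℝ (curl (u t')) x)))) :
    ∀ (C ν T : ℝ) (u : ℝ → EuclideanSpace ℝ (Fin 3) → EuclideanSpace ℝ (Fin 3)) (p : ℝ → EuclideanSpace ℝ (Fin 3) → ℝ),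
      IsViolator C ν T u p →
      ∀ (Θ G H τ₁ : ℝ), 0 < Θ → 0 < G → 0 < H → 0 < τ₁ → ∃ ε : ℝ, 0 < ε ∧
      ∀ (t M : ℝ), 0 ≤ t → 0 < M → t + τ₁ * ν / M ^ 2 < T → M = C * Real.sqrt ν / Real.sqrt (T - t) →
        (∀ x, ‖u t x‖ ≤ M) →
        (∫ x, ‖curl (u t) x‖ ^ 2) ≤ Θ * (ν / M) ^ 2 * (∫ x, frobeniusNormSq (fderiv ℝ (curl (u t)) x)) →
        (∀ x, ‖fderiv ℝ (u t) x‖ ≤ G * M ^ 2 / ν) →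
        (∀ t' ∈ Set.Icc t (t + τ₁ * ν / M ^ 2), ∀ x, ‖u t' x‖ ≤ H * M) →
        ENNReal.ofReal (ε * (τ₁ * ν / M ^ 2)) ≤
          volume ({t' : ℝ | ∀ M' : ℝ, (∀ x, ‖u t' x‖ ≤ M') →
              |∫ x, ⟪curl (u t') x, fderiv ℝ (u t') x (curl (u t') x)⟫_ℝ| ≤
                (kStar - ε) * M' * Real.sqrt (∫ x, ‖curl (u t') x‖ ^ 2) *
                  Real.sqrt (∫ x, frobeniusNormSq (fderiv ℝ (curl (u t')) x))} ∩
            Set.Icc t (t + τ₁ * ν / M ^ 2)) := by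
  have hR := relayObstruction_holds
  intro C ν T u p hV Θ G H τ₁ hΘ hG hH hτ₁
  have hν : 0 < ν := hV.2.1
  obtain ⟨δ₀, η, Λ, hδ₀, hδ₀κ, hη, hΛ, hΛη, hwin⟩ := hD C ν T u p hV Θ G H τ₁ hΘ hG hH hτ₁
  set ε : ℝ := min (δ₀ / 2) ((1 - 2 * Λ * η) / 2) with hεdef
  have hε : 0 < ε := lt_min (by linarith) (by linarith)
  have hε1 : ε ≤ δ₀ / 2 := min_le_left _ _
  have hε2 : ε ≤ 1 - 2 * Λ * η := (min_le_right _ _).trans (by linarith)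
  refine ⟨ε, hε, ?_⟩
  intro t M ht hM htT hpin hMb hlock hgrad hheights
  have hL : 0 < τ₁ * ν / M ^ 2 := by positivity
  obtain ⟨w, q, hwm, hqm, hw0, hsum, hqle, hpers, htrans, hdom⟩ :=
    hwin t M ht hM htT hpin hMb hlock hgrad hheights
  have hRB := hR kStar δ₀ η Λ ε t (τ₁ * ν / M ^ 2) hδ₀ hδ₀κ hη hΛ hε hε1 hε2 hL w q hwm hqm hw0 hsum hqle hpers htrans
  refine hRB.trans (measure_mono ?_)
  rintro t' ⟨hle, ht'I⟩
  refine ⟨fun M' hM' => ?_, ht'I⟩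
  have hM'0 : 0 ≤ M' := (norm_nonneg _).trans (hM' 0)
  have hfac : 0 ≤ M' * Real.sqrt (∫ x, ‖curl (u t') x‖ ^ 2) *
      Real.sqrt (∫ x, frobeniusNormSq (fderiv ℝ (curl (u t')) x)) := by positivity
  calc |∫ x, ⟪curl (u t') x, fderiv ℝ (u t') x (curl (u t') x)⟫_ℝ|
      ≤ (∑' i, w i t' * q i t') * M' * Real.sqrt (∫ x, ‖curl (u t') x‖ ^ 2) *
          Real.sqrt (∫ x, frobeniusNormSq (fderiv ℝ (curl (u t')) x)) := hdom t' ht'I M' hM'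
    _ = (∑' i, w i t' * q i t') * (M' * Real.sqrt (∫ x, ‖curl (u t') x‖ ^ 2) *
          Real.sqrt (∫ x, frobeniusNormSq (fderiv ℝ (curl (u t')) x))) := by ring
    _ ≤ (kStar - ε) * (M' * Real.sqrt (∫ x, ‖curl (u t') x‖ ^ 2) *
          Real.sqrt (∫ x, frobeniusNormSq (fderiv ℝ (curl (u t')) x))) := mul_le_mul_of_nonneg_right hle hfac
    _ = (kStar - ε) * M' * Real.sqrt (∫ x, ‖curl (u t') x‖ ^ 2) *
          Real.sqrt (∫ x, frobeniusNormSq (fderiv ℝ (curl (u t')) x)) := by ring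

/-! ### §3 The heart D♭ closes the crux BY NAME -/

/-- **LINE g13-β `relay` COMPOSITION on the Theorems side** (= the skeleton's `NearExtremalTransiencePerFlow_of_heart hD`, heart
VERBATIM): the heart D♭ `CellRelayDecomposition` concludes the crux `NearExtremalTransiencePerFlow` BY NAME — relay cut (R♭ proved)
then the pinned sandwich (W♭⁺ proved). [folklore] -/
theorem nearExtremalTransiencePerFlow_of_cellRelayDecomposition
    (hD : ∀ (C ν T : ℝ) (u : ℝ → EuclideanSpace ℝ (Fin 3) → EuclideanSpace ℝ (Fin 3)) (p : ℝ → EuclideanSpace ℝ (Fin 3) → ℝ),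
      IsViolator C ν T u p →
      ∀ (Θ G H τ₁ : ℝ), 0 < Θ → 0 < G → 0 < H → 0 < τ₁ →
      ∃ δ₀ η Λ : ℝ, 0 < δ₀ ∧ δ₀ ≤ kStar ∧ 0 ≤ η ∧ 1 ≤ Λ ∧ 2 * Λ * η < 1 ∧
      ∀ (t M : ℝ), 0 ≤ t → 0 < M → t + τ₁ * ν / M ^ 2 < T → M = C * Real.sqrt ν / Real.sqrt (T - t) →
        (∀ x, ‖u t x‖ ≤ M) →
        (∫ x, ‖curl (u t) x‖ ^ 2) ≤ Θ * (ν / M) ^ 2 * (∫ x, frobeniusNormSq (fderiv ℝ (curl (u t)) x)) →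
        (∀ x, ‖fderiv ℝ (u t) x‖ ≤ G * M ^ 2 / ν) →
        (∀ t' ∈ Set.Icc t (t + τ₁ * ν / M ^ 2), ∀ x, ‖u t' x‖ ≤ H * M) →
        ∃ (w q : ℕ → ℝ → ℝ),
          (∀ i, Measurable (w i)) ∧ (∀ i, Measurable (q i)) ∧
          (∀ i t', 0 ≤ w i t') ∧
          (∀ t' ∈ Set.Icc t (t + τ₁ * ν / M ^ 2), Summable (fun i => w i t') ∧ ∑' i, w i t' ≤ 1) ∧
          (∀ i, ∀ t' ∈ Set.Icc t (t + τ₁ * ν / M ^ 2), q i t' ≤ kStar) ∧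
          (∀ i, ∀ t' ∈ Set.Icc t (t + τ₁ * ν / M ^ 2), w i t' ≤ Λ * w i t) ∧
          (∀ i, volume ({t' : ℝ | kStar - δ₀ < q i t'} ∩ Set.Icc t (t + τ₁ * ν / M ^ 2)) ≤
            ENNReal.ofReal (η * (τ₁ * ν / M ^ 2))) ∧
          (∀ t' ∈ Set.Icc t (t + τ₁ * ν / M ^ 2), ∀ M' : ℝ, (∀ x, ‖u t' x‖ ≤ M') →
            |∫ x, ⟪curl (u t') x, fderiv ℝ (u t') x (curl (u t') x)⟫_ℝ| ≤
              (∑' i, w i t' * q i t') * M' * Real.sqrt (∫ x, ‖curl (u t') x‖ ^ 2) *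
                Real.sqrt (∫ x, frobeniusNormSq (fderiv ℝ (curl (u t')) x)))) :
    NearExtremalTransiencePerFlow :=
  nearExtremalTransiencePerFlow_of_pinnedDepletedFraction (pinnedDepletedFraction_of_cellRelayDecomposition hD)

end Summit.NavierStokesRegularity.NavierStokesRegularity.Theorems.NearExtremalTransiencePerFlow.PinnedDepletion

end
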